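import Literature.Topology.FourManifolds.RLinkSphereHomotopySphere
import Literature.Topology.FourManifolds.FramedLinkTraceEuler
import Literature.Topology.FourManifolds.BoundaryGluingVanKampen
import Literature.Topology.FourManifolds.GluingProofs
import Literature.Topology.FourManifolds.OneHandlebodyBoundaryCarrier
import Literature.Topology.FourManifolds.MorseEulerEqualities
import Literature.Topology.FourManifolds.SimplyConnectedEulerCharacteristic
import Literature.Topology.FourManifolds.SecondHomologyOfFirstHomologyZero
import Literature.Topology.FourManifolds.SPC4Wave0Proofs
import Literature.AlgebraicTopology.FundamentalGroup.MapOfEqRange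
import HarnessLib

/-!
# An R-link sphere is a homotopy `4`-sphere: discharge of
# `IsRLinkSphere.nonempty_homotopyEquiv_sphere`

Topic `Literature/Topology/FourManifolds`; fact seat of the named fact
`Literature.Topology.FourManifolds.IsRLinkSphere.nonempty_homotopyEquiv_sphere`
(`RLinkSphereHomotopySphere.lean`).  R. E. Gompf, M. Scharlemann, A. Thompson, *Fibered knots and
potential counterexamples to the Property 2R and Slice-Ribbon Conjectures*, Geom. Topol. 14 (2010)
2305–2347, §9 (arXiv:1103.1601, p. 19): for the closed `4`-manifold `W = D⁴ ∪_L (2-handles) ∪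
♮ⁿ(S¹ × B³)`, *"The result is a simply-connected (since no `1`-handles are attached) homology
`4`-sphere, hence a homotopy `4`-sphere"*; proof of Prop. 9.2 (p. 20): *"Since `Σ` has Euler
characteristic 2 …"*.  The printed architecture is followed:

* **`π₁ = 1`** (`simplyConnectedSpace_of_isTrace_of_handleCount_one`): van Kampen for the boundary
  gluing `X = P ∪_φ V` (`BoundaryGluingData.simplyConnectedSpace_of_normalClosure_eq_top`,
  `BoundaryGluingVanKampen.lean`): the trace `P` is simply connected (no `1`-handles,
  `FramedLink.IsTrace.simplyConnectedSpace`, `FramedLinkTraceSimplyConnected.lean`) and every loop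
  of the `1`-handlebody `V ≅ ♮ⁿ S¹ × B³` comes from its boundary
  (`HasHandleDecomposition.bijective_mapOfEq_inclContinuousMap`), hence from `P`, where it dies.
* **homology sphere** (`relEuler_eq_two_of_isTrace_of_handleCount_one`,
  `isZero_singularHomology_two_of_isTrace_of_handleCount_one`): `χ(X) = χ(P) + χ(X, P) =
  χ(P) + χ(V, ∂V) = (n + 1) + (1 - n) = 2` (excision for the gluing,
  `BoundaryGluingData.isIso_map_jB_boundary'`; the trace, `FramedLink.IsTrace.finRelHomology`;
  the Morse count of the `(1,n)`-handlebody turned about, `IsMorseAdapted.finRelHomology_boundary`),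
  and for a closed simply connected `4`-manifold `χ = 2 + b₂` with `H₂` free
  (`relEuler_eq_two_add_finrank_singularHomology_two_of_simplyConnectedSpace`,
  `free_singularHomology_two_of_isZero_one`), so `H₂(X; ℤ) = 0`;
* **hence a homotopy sphere**: the tree's proved recognition theorem
  `nonempty_homotopyEquiv_sphere_four_iff_holds` (Hurewicz and Whitehead, `SPC4Wave0Proofs.lean`).

Main statement: **`IsRLinkSphere.nonempty_homotopyEquiv_sphere_holds`**.  Everything is proved;
no definitions, no named facts.

## References

* R. E. Gompf, M. Scharlemann, A. Thompson, Geom. Topol. 14 (2010) 2305–2347 (arXiv:1103.1601),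
  §9 (p. 19) and proof of Prop. 9.2 (p. 20). [GompfScharlemannThompson2010]
* R. C. Kirby, *The Topology of 4-Manifolds*, LNM 1374 (1989), Ch. I §2, Ch. II §1. [Kirby1989]
* A. Hatcher, *Algebraic Topology* (2002), §1.2 (van Kampen), §2.2 Thm. 2.44, Cor. 4.33.
  [HatcherAT2002]
-/

open scoped Manifold ContDiff Topology ContinuousMap
open Set Function Metric CategoryTheory Limits

noncomputable section

namespace Literature.Topology.FourManifolds

open Literature.AlgebraicTopology.SingularHomology Literature.AlgebraicTopology.FundamentalGroup

section Pieces

variable {n : ℕ} {L : FramedLink (Fin n)}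
  {X : Type} [TopologicalSpace X] [ChartedSpace (EuclideanSpace ℝ (Fin 4)) X]
  [IsManifold (𝓡 4) ∞ X]
  {P : Type} [TopologicalSpace P] [T2Space P] [SecondCountableTopology P]
  [ChartedSpace (EuclideanHalfSpace 4) P] [IsManifold (𝓡∂ 4) ∞ P] [CompactSpace P]
  {V : Type} [TopologicalSpace V] [T2Space V] [SecondCountableTopology V]
  [ChartedSpace (EuclideanHalfSpace 4) V] [IsManifold (𝓡∂ 4) ∞ V] [CompactSpace V]
  [ConnectedSpace V] {bP : BoundaryData (𝓡∂ 4) P (𝓡 3)} {bV : BoundaryData (𝓡∂ 4) V (𝓡 3)}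
  {φ : bP.carrier ≃ₘ⟮𝓡 3, 𝓡 3⟯ bV.carrier}

/-- **`X = (trace) ∪_φ (1-handlebody)` is simply connected** — Gompf–Scharlemann–Thompson 2010,
§9: *"simply-connected (since no `1`-handles are attached)"*.  Van Kampen for the boundary gluing
(`BoundaryGluingData.simplyConnectedSpace_of_normalClosure_eq_top`): `π₁(P) = 1`
(`FramedLink.IsTrace.simplyConnectedSpace`), and `π₁(V)` is the image of `π₁(∂V)`
(`HasHandleDecomposition.bijective_mapOfEq_inclContinuousMap`), whose loops, read in `X`, lie in
the image of `P`. [cite: GompfScharlemannThompson2010, §9 (arXiv p. 19)]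
[cite: HatcherAT2002, §1.2 Thm. 1.20 and Prop. 1.26] -/
theorem simplyConnectedSpace_of_isTrace_of_handleCount_one (hP : L.IsTrace P)
    (hV : HasHandleDecomposition 3 V (handleCount 1 n)) (hX : IsBoundaryGluing bP bV φ (𝓡 4) X) :
    SimplyConnectedSpace X := by
  obtain ⟨G⟩ := hX.nonempty_boundaryGluingData'
  -- the pieces as null-cobordisms of their boundaries
  let cP : NullCobordism 3 bP.carrier :=
    { W := P
      incl := bP.incl
      isSmoothEmbedding_incl := bP.isSmoothEmbedding
      range_incl := bP.range_incl }
  let cV : NullCobordism 3 bV.carrier :=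
    { W := V
      incl := bV.incl
      isSmoothEmbedding_incl := bV.isSmoothEmbedding
      range_incl := bV.range_incl }
  let G' : BoundaryGluingData cP.boundaryData cV.boundaryData φ.toEquiv X := G
  -- instances on the boundary manifolds
  haveI : CompactSpace bV.carrier := bV.compactSpace_carrier
  haveI : T2Space bV.carrier := bV.t2Space_carrier
  haveI : PathConnectedSpace bV.carrier := hV.pathConnectedSpace_carrier bV (by norm_num)
  haveI : CompactSpace bP.carrier := bP.compactSpace_carrier
  haveI : T2Space bP.carrier := bP.t2Space_carrier
  haveI : Nonempty bP.carrier := ⟨φ.symm (Classical.arbitrary _)⟩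
  haveI : PathConnectedSpace bP.carrier :=
    φ.toHomeomorph.symm.surjective.pathConnectedSpace φ.toHomeomorph.symm.continuous
  haveI : SimplyConnectedSpace P := hP.simplyConnectedSpace
  haveI : PathConnectedSpace cP.W := hP.pathConnectedSpace
  haveI : LocallyPathConnectedSpace V :=
    ChartedSpace.locallyPathConnectedSpace (EuclideanHalfSpace 4) V
  haveI : PathConnectedSpace cV.W := pathConnectedSpace_iff_connectedSpace.2 ‹ConnectedSpace V›
  obtain ⟨z₀⟩ := (inferInstance : Nonempty bP.carrier)
  -- the loops of `V` coming from the boundary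
  let iV := FundamentalGroup.mapOfEq bV.inclContinuousMap
    (rfl : bV.inclContinuousMap (φ z₀) = bV.incl (φ z₀))
  refine G'.simplyConnectedSpace_of_normalClosure_eq_top z₀ (A := univ) (B := Set.range iV)
    ?_ ?_ ?_ ?_
  · exact top_le_iff.1 fun g _ => Subgroup.subset_normalClosure (mem_univ g)
  · -- `π₁(∂V) → π₁(V)` is onto
    have hsurj : Surjective iV := (hV.bijective_mapOfEq_inclContinuousMap bV le_rfl (φ z₀)).2
    exact top_le_iff.1 fun g _ => Subgroup.subset_normalClosure (hsurj g)
  · intro a _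
    rw [Subsingleton.elim a 1, map_one]
  · -- a boundary loop of `V`, read in `X`, is a loop of `P`
    rintro _ ⟨c, rfl⟩
    -- `jB ∘ incl_V = jA ∘ incl_P ∘ φ⁻¹` on `∂V`
    let g : C(bV.carrier, P) := ⟨fun w => bP.incl (φ.symm w),
      bP.continuous_incl.comp φ.symm.continuous⟩
    set jBc : C(cV.W, X) := ⟨G'.jB, G'.continuous_jB⟩
    have hfac : jBc.comp bV.inclContinuousMap =
        (⟨G'.jA, G'.continuous_jA⟩ : C(cP.W, X)).comp g := by
      ext w
      exact G.jB_incl w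
    have hg : g (φ z₀) = bP.incl z₀ := by
      show bP.incl (φ.symm (φ z₀)) = bP.incl z₀
      rw [Diffeomorph.symm_apply_apply]
    have h₁ : FundamentalGroup.mapOfEq jBc (G'.jB_incl_eq_jA_incl z₀) (iV c) =
        FundamentalGroup.mapOfEq (jBc.comp bV.inclContinuousMap)
          (show (jBc.comp bV.inclContinuousMap) (φ z₀) = G'.jA (cP.incl z₀) from
            G'.jB_incl_eq_jA_incl z₀) c :=
      (mapOfEq_comp_apply bV.inclContinuousMap jBc rfl (G'.jB_incl_eq_jA_incl z₀) c).symm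
    have h₂ : FundamentalGroup.mapOfEq (jBc.comp bV.inclContinuousMap)
          (show (jBc.comp bV.inclContinuousMap) (φ z₀) = G'.jA (cP.incl z₀) from
            G'.jB_incl_eq_jA_incl z₀) c =
        FundamentalGroup.mapOfEq ((⟨G'.jA, G'.continuous_jA⟩ : C(cP.W, X)).comp g)
          (show ((⟨G'.jA, G'.continuous_jA⟩ : C(cP.W, X)).comp g) (φ z₀) = G'.jA (cP.incl z₀) by
            rw [ContinuousMap.comp_apply, hg]; rfl) c :=
      FundamentalGroup.mapOfEq_congr hfac _ c
    have h₃ : FundamentalGroup.mapOfEq ((⟨G'.jA, G'.continuous_jA⟩ : C(cP.W, X)).comp g)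
          (show ((⟨G'.jA, G'.continuous_jA⟩ : C(cP.W, X)).comp g) (φ z₀) = G'.jA (cP.incl z₀) by
            rw [ContinuousMap.comp_apply, hg]; rfl) c =
        FundamentalGroup.mapOfEq (⟨G'.jA, G'.continuous_jA⟩ : C(cP.W, X))
          (rfl : G'.jA (cP.incl z₀) = G'.jA (cP.incl z₀)) (FundamentalGroup.mapOfEq g hg c) :=
      mapOfEq_comp_apply g (⟨G'.jA, G'.continuous_jA⟩ : C(cP.W, X)) hg rfl c
    have h₄ : FundamentalGroup.mapOfEq (⟨G'.jA, G'.continuous_jA⟩ : C(cP.W, X))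
          (rfl : G'.jA (cP.incl z₀) = G'.jA (cP.incl z₀)) (FundamentalGroup.mapOfEq g hg c) =
        1 := by
      rw [Subsingleton.elim (FundamentalGroup.mapOfEq g hg c) 1, map_one]
    exact h₁.trans (h₂.trans (h₃.trans h₄))

omit [ConnectedSpace V] in
/-- **`χ(V, ∂V) = 1 - n` for a compact `4`-dimensional `(1, n)`-handlebody `V`** (one `0`-handle,
`n` `1`-handles), with the finiteness of `H_•(V, ∂V; ℤ)`: the Morse equality for the handle
decomposition turned about (`IsMorseAdapted.finRelHomology_boundary`; Milnor 1965, §3 and proof of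
Thm. 9.1). [cite: MilnorHCobordism1965, proof of Thm. 9.1 (PDF p. 57), with §3 (PDF p. 21)] -/
theorem finRelHomology_boundary_of_handleCount_one
    (hV : HasHandleDecomposition 3 V (handleCount 1 n)) :
    FinRelHomology ℤ ℤ V ((𝓡∂ 4).boundary V) 5 ∧
      relEuler ℤ ℤ V ((𝓡∂ 4).boundary V) = 1 - n := by
  obtain ⟨f, hf, hcount⟩ := hV
  obtain ⟨hfin, hχ⟩ := hf.finRelHomology_boundary ℤ ℤ
  refine ⟨hfin, ?_⟩
  rw [hχ, Module.finrank_self]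
  simp only [Finset.sum_range_succ, Finset.sum_range_zero, hcount]
  norm_num [handleCount]
  ring

/-- **`χ(X) = 2` for `X = (trace of an `n`-component framed link) ∪_φ ((1, n)-handlebody)`** —
the handle count `1 - 0 + n - n + 1` of Gompf–Scharlemann–Thompson 2010, proof of Prop. 9.2
(*"Since `Σ` has Euler characteristic 2"*): `χ(X) = χ(P) + χ(X, P)` (exact sequence of the pair),
`χ(X, P) = χ(V, ∂V) = 1 - n` (excision for the gluing, `BoundaryGluingData.isIso_map_jB_boundary'`,
and the Morse count), `χ(P) = n + 1` (`FramedLink.IsTrace.finRelHomology`); with the finiteness of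
`H_•(X; ℤ)`. [cite: GompfScharlemannThompson2010, proof of Prop. 9.2 (arXiv p. 20)]
[cite: HatcherAT2002, §2.2 Thm. 2.44] -/
theorem relEuler_eq_two_of_isTrace_of_handleCount_one (hP : L.IsTrace P)
    (hV : HasHandleDecomposition 3 V (handleCount 1 n)) (hX : IsBoundaryGluing bP bV φ (𝓡 4) X) :
    FinRelHomology ℤ ℤ X ∅ (n + 5) ∧ relEuler ℤ ℤ X ∅ = 2 := by
  obtain ⟨G⟩ := hX.nonempty_boundaryGluingData'
  let cP : NullCobordism 3 bP.carrier :=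
    { W := P
      incl := bP.incl
      isSmoothEmbedding_incl := bP.isSmoothEmbedding
      range_incl := bP.range_incl }
  let cV : NullCobordism 3 bV.carrier :=
    { W := V
      incl := bV.incl
      isSmoothEmbedding_incl := bV.isSmoothEmbedding
      range_incl := bV.range_incl }
  let G' : BoundaryGluingData cP.boundaryData cV.boundaryData φ.toEquiv X := G
  haveI : CompactSpace bV.carrier := bV.compactSpace_carrier
  haveI : T2Space bV.carrier := bV.t2Space_carrier
  haveI : PathConnectedSpace bV.carrier := hV.pathConnectedSpace_carrier bV (by norm_num)
  -- `χ(X, jA P) = χ(V, ∂V) = 1 - n`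
  obtain ⟨hVfin, hVχ⟩ := finRelHomology_boundary_of_handleCount_one (V := V) hV
  have eV : ∀ k, relativeSingularHomology ℤ ℤ cV.W ((𝓡∂ (2 + 1 + 1)).boundary cV.W) k ≅
      relativeSingularHomology ℤ ℤ X (range G'.jA) k := fun k =>
    haveI := G'.isIso_map_jB_boundary' ℤ ℤ k
    asIso (relativeSingularHomology.map ℤ ℤ (⟨G'.jB, G'.continuous_jB⟩ : C(cV.W, X))
      G'.mapsTo_jB_boundary k)
  have hXA : FinRelHomology ℤ ℤ X (range G'.jA) (n + 5) := (hVfin.of_iso eV).mono (by omega)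
  have hχXA : relEuler ℤ ℤ X (range G'.jA) = 1 - n := (relEuler_eq_of_iso eV).symm.trans hVχ
  -- `χ(jA P) = χ(P) = n + 1`
  obtain ⟨hPfin, hPχ⟩ := hP.finRelHomology
  let eP : P ≃ₜ ↥(range G'.jA) := G'.isSmoothEmbedding_jA.isEmbedding.toHomeomorph
  have hA : FinRelHomology ℤ ℤ ↥(range G'.jA) (Subtype.val ⁻¹' (∅ : Set X)) (n + 5) :=
    ((hPfin.of_homeomorph eP (mapsTo_empty _ _) (mapsTo_empty _ _)).mono (by
      rw [Fintype.card_fin]; omega)).congr_set (by simp)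
  have hχA : relEuler ℤ ℤ ↥(range G'.jA) (Subtype.val ⁻¹' (∅ : Set X)) = n + 1 := by
    rw [← relEuler_congr_set (Set.preimage_empty).symm,
      ← relEuler_eq_of_homeomorph (R := ℤ) (M := ℤ) eP (mapsTo_empty _ _) (mapsTo_empty _ _), hPχ,
      Fintype.card_fin]
    ring
  -- the exact sequence of the pair `(X, jA P)`
  obtain ⟨hXfin, hχ⟩ := FinRelHomology.triple_mid (M := ℤ) (empty_subset (range G'.jA)) hA hXA
  refine ⟨hXfin, ?_⟩
  rw [hχ, hχA, hχXA]
  ring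

/-- **`H₂(X; ℤ) = 0`**: `X` is a closed simply connected `4`-manifold with `χ(X) = 2`, and for
such `χ = 2 + rank H₂` with `H₂` free (Kirby 1989, Ch. II §1; the tree's
`relEuler_eq_two_add_finrank_singularHomology_two_of_simplyConnectedSpace`,
`free_singularHomology_two_of_isZero_one`) — the "homology `4`-sphere" of
Gompf–Scharlemann–Thompson 2010, §9. [cite: GompfScharlemannThompson2010, §9 (arXiv p. 19)]
[cite: Kirby1989, Ch. II §1] -/
theorem isZero_singularHomology_two_of_isTrace_of_handleCount_one [T2Space X] (hP : L.IsTrace P)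
    (hV : HasHandleDecomposition 3 V (handleCount 1 n)) (hX : IsBoundaryGluing bP bV φ (𝓡 4) X) :
    IsZero (singularHomology ℤ ℤ X 2) := by
  haveI : CompactSpace X := hX.compactSpace
  haveI : SimplyConnectedSpace X := simplyConnectedSpace_of_isTrace_of_handleCount_one hP hV hX
  have hχ := relEuler_eq_two_add_finrank_singularHomology_two_of_simplyConnectedSpace (X := X)
  rw [(relEuler_eq_two_of_isTrace_of_handleCount_one hP hV hX).2] at hχ
  have hr : Module.finrank ℤ (singularHomology ℤ ℤ X 2) = 0 := by exact_mod_cast (by linarith)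
  obtain ⟨μ⟩ := isOrientableOver_int_four_of_simplyConnectedSpace (X := X)
  have h₁ : IsZero (singularHomology ℤ ℤ X 1) :=
    isZero_singularHomology_one_of_simplyConnectedSpace ℤ ℤ (X := X)
  haveI := free_singularHomology_two_of_isZero_one μ h₁
  haveI := finite_singularHomology_two_of_isZero_one μ h₁
  rw [ModuleCat.isZero_iff_subsingleton]
  exact Module.finrank_zero_iff.1 hr

end Pieces

/-! ### The discharge -/

/-- **Discharge of the named fact `IsRLinkSphere.nonempty_homotopyEquiv_sphere`**
(Gompf–Scharlemann–Thompson 2010, §9, arXiv p. 19: the closed `4`-manifold of an R-link *"is a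
simply-connected (since no `1`-handles are attached) homology `4`-sphere, hence a homotopy
`4`-sphere"*): a Hausdorff, second countable smooth `X` with `IsRLinkSphere X L` is homotopy
equivalent to `S⁴` — `π₁(X) = 1` and `H₂(X; ℤ) = 0` by the two theorems above, then the tree's
recognition of homotopy `4`-spheres `nonempty_homotopyEquiv_sphere_four_iff_holds` (Hurewicz and
Whitehead). [cite: GompfScharlemannThompson2010, §9 and proof of Prop. 9.2 (arXiv pp. 19–20)] -/
theorem IsRLinkSphere.nonempty_homotopyEquiv_sphere_holds :
    IsRLinkSphere.nonempty_homotopyEquiv_sphere := by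
  intro n L X _ _ _ _ _ hXL
  obtain ⟨P, _, _, _, _, _, _, V, _, _, _, _, _, _, _, bP, bV, φ, hP, hV, -, hX⟩ := hXL
  haveI : CompactSpace X := hX.compactSpace
  have hsc : SimplyConnectedSpace X := simplyConnectedSpace_of_isTrace_of_handleCount_one hP hV hX
  have hH : IsZero (singularHomologyZ X 2) := by
    change IsZero (singularHomology ℤ ℤ X 2)
    exact isZero_singularHomology_two_of_isTrace_of_handleCount_one hP hV hX
  exact (nonempty_homotopyEquiv_sphere_four_iff_holds X).2 ⟨hsc, hH⟩

end Literature.Topology.FourManifolds
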